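import Summits.MatrixMultiplication.OmegaCensus.EisPhaseBlocks

/-!
# ω-census, family (b3): conjecture C9 — 2-D PHASE BLOCKS for `𝔽_p[x]/(x² − bx − a) ⋊_u ℤ/q` (any quadratic algebra, any `q`, any `u`)

HONEST FRAMING (pub-omega census; verbatim): lottery ticket; floor = certified bounds/negative ranges.
Census BOOKKEEPING (conjecture C9 of the cell; pub-omega stpp-1 gen 21).  `EisPhaseBlocks.lean` VERBATIM with
`Eis p = QuadraticAlgebra (ZMod p) (−1) (−1)`, `q = 3`, `u = ω` replaced by an arbitrary quadratic algebra
`QuadraticAlgebra (ZMod p) a b` (a `Fintype` instance is taken as an argument), any `q` and any `u` (`RCyc.RBox _ q`, data indexed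
by `ZMod q`): `blockCells`, **`patIndep_blockCells`** (`PairOK(re) ∨ PairOK(im)` per pair), `blockArcSet ⊆ blockCells`,
**`card_blockArcSet`**; the 1-D pieces (`PhiR`, `coord_noConflict`, `bStart/bStop/bLen`, `eight_mul_bLen_ge`, `b_bounds`) are
reused from `EisArcs`.  PURPOSE: the Schmidt atoms `A(p,5)` with `k = 2` — the 'golden family' `𝔽_p[ζ₅] ⋊ C₅`, `p ≡ 4 (mod 5)`,
`R = QuadraticAlgebra (ZMod p) (−1) τ` with `τ² + τ = 1`, `ζ = ⟨0,1⟩` — whose products `ζ^s κ α` (`α = e₀/8`, `(e₀, τe₀)` a Thue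
vector) have coordinates `(c₀e₀ + c₁e₁)/8`, i.e. `O(√p)` errors in both coordinates (seat numerics `code/golden.py`: every one of
the 48 phase classes has a 2-D pattern of ≥ 128/576 blocks; plan in HOME/pub-omega-stpp-1-g21/ATOMS-NONNILPOTENT-C9.md).
Nothing here is progress on `ω`.
-/

namespace Summit.MatrixMultiplication.OmegaCensus

open Finset

namespace QuadArcs

variable {p : ℕ} {a b : ZMod p} {q : ℕ} [Fintype (QuadraticAlgebra (ZMod p) a b)]

open EisArcs (PhiR coord_noConflict bStart bStop bLen eight_mul_bLen_ge b_bounds)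

/-- The 2-D phase-block cell set: `(c, V)` with `re V` in the trimmed block `φ.1` and `im V` in the trimmed block `φ.2` for some
`φ ∈ P c`. [folklore] -/
def blockCells (p : ℕ) [NeZero p] (a b : ZMod p) [Fintype (QuadraticAlgebra (ZMod p) a b)] (P : Fin 3 × Fin 3 → Finset (ℤ × ℤ))
    (lo₁ hi₁ lo₂ hi₂ : Fin 3 × Fin 3 → ℤ × ℤ → ℤ) : Finset ((Fin 3 × Fin 3) × QuadraticAlgebra (ZMod p) a b) :=
  univ.filter fun x => ∃ φ ∈ P x.1,
    (φ.1 * p + lo₁ x.1 φ ≤ 8 * (x.2.re.val : ℤ) ∧ 8 * (x.2.re.val : ℤ) + hi₁ x.1 φ < (φ.1 + 1) * p) ∧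
    (φ.2 * p + lo₂ x.1 φ ≤ 8 * (x.2.im.val : ℤ) ∧ 8 * (x.2.im.val : ℤ) + hi₂ x.1 φ < (φ.2 + 1) * p)

/-- Membership in the block cell set. [folklore] -/
theorem mem_blockCells [NeZero p] {P : Fin 3 × Fin 3 → Finset (ℤ × ℤ)} {lo₁ hi₁ lo₂ hi₂ : Fin 3 × Fin 3 → ℤ × ℤ → ℤ}
    {x : (Fin 3 × Fin 3) × QuadraticAlgebra (ZMod p) a b} : x ∈ blockCells p a b P lo₁ hi₁ lo₂ hi₂ ↔ ∃ φ ∈ P x.1,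
    (φ.1 * p + lo₁ x.1 φ ≤ 8 * (x.2.re.val : ℤ) ∧ 8 * (x.2.re.val : ℤ) + hi₁ x.1 φ < (φ.1 + 1) * p) ∧
    (φ.2 * p + lo₂ x.1 φ ≤ 8 * (x.2.im.val : ℤ) ∧ 8 * (x.2.im.val : ℤ) + hi₂ x.1 φ < (φ.2 + 1) * p) := by
  simp only [blockCells, mem_filter, mem_univ, true_and]

/-- **2-D phase blocks are independent** under `PairOK(re) ∨ PairOK(im)` for every pair of columns and phases. [folklore] -/
theorem patIndep_blockCells [NeZero p] (D : RCyc.RBox (QuadraticAlgebra (ZMod p) a b) q)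
    (u : QuadraticAlgebra (ZMod p) a b) (aR eR bR fR aI eI bI fI : ZMod q → Fin 3 → ℤ)
    (hαR : ∀ s i, 8 * ((RCyc.act u s * D.α i).re.val : ℤ) = aR s i * p + eR s i)
    (hβR : ∀ s j, 8 * ((RCyc.act u s * D.β j).re.val : ℤ) = bR s j * p + fR s j)
    (hαI : ∀ s i, 8 * ((RCyc.act u s * D.α i).im.val : ℤ) = aI s i * p + eI s i)
    (hβI : ∀ s j, 8 * ((RCyc.act u s * D.β j).im.val : ℤ) = bI s j * p + fI s j)
    (P : Fin 3 × Fin 3 → Finset (ℤ × ℤ)) (lo₁ hi₁ lo₂ hi₂ : Fin 3 × Fin 3 → ℤ × ℤ → ℤ)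
    (hlo₁ : ∀ c, ∀ φ ∈ P c, 0 ≤ lo₁ c φ) (hhi₁ : ∀ c, ∀ φ ∈ P c, 0 ≤ hi₁ c φ)
    (hlo₂ : ∀ c, ∀ φ ∈ P c, 0 ≤ lo₂ c φ) (hhi₂ : ∀ c, ∀ φ ∈ P c, 0 ≤ hi₂ c φ)
    (hcond : ∀ c c', c ≠ c' → ∀ φ ∈ P c, ∀ φ' ∈ P c',
      PhaseArcs.PairOK p (PhiR D aR bR c c') (PhiR D eR fR c c') φ.1 φ'.1 (lo₁ c φ) (hi₁ c φ) (lo₁ c' φ') (hi₁ c' φ') ∨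
      PhaseArcs.PairOK p (PhiR D aI bI c c') (PhiR D eI fI c c') φ.2 φ'.2 (lo₂ c φ) (hi₂ c φ) (lo₂ c' φ') (hi₂ c' φ')) :
    D.PatIndep u (blockCells p a b P lo₁ hi₁ lo₂ hi₂) := by
  intro x hx y hy hxy heq
  obtain ⟨φ, hφ, ⟨hx1, hx2⟩, ⟨hx3, hx4⟩⟩ := mem_blockCells.1 hx
  obtain ⟨φ', hφ', ⟨hy1, hy2⟩, ⟨hy3, hy4⟩⟩ := mem_blockCells.1 hy
  by_cases hc : x.1 = y.1
  · rw [hc, RCyc.RBox.dd_self, sub_eq_zero] at heq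
    exact hxy (Prod.ext hc heq)
  rw [RCyc.RBox.dd_eq_four] at heq
  set s₁ : ZMod q := D.a x.1.1 + D.b y.1.2
  set s₂ : ZMod q := D.a x.1.1 + D.b x.1.2
  set s₃ : ZMod q := D.a y.1.1 + D.b y.1.2
  rcases hcond x.1 y.1 hc φ hφ φ' hφ' with hok | hok
  · have hre := congrArg QuadraticAlgebra.re heq
    simp only [QuadraticAlgebra.re_sub, QuadraticAlgebra.re_add] at hre
    exact coord_noConflict hre (hαR s₁ y.1.1) (hβR s₁ x.1.2) (hβR s₂ y.1.2) (hαR s₃ x.1.1)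
      (hlo₁ _ _ hφ) (hhi₁ _ _ hφ) (hlo₁ _ _ hφ') (hhi₁ _ _ hφ') hx1 hx2 hy1 hy2 hok
  · have him := congrArg QuadraticAlgebra.im heq
    simp only [QuadraticAlgebra.im_sub, QuadraticAlgebra.im_add] at him
    exact coord_noConflict him (hαI s₁ y.1.1) (hβI s₁ x.1.2) (hβI s₂ y.1.2) (hαI s₃ x.1.1)
      (hlo₂ _ _ hφ) (hhi₂ _ _ hφ) (hlo₂ _ _ hφ') (hhi₂ _ _ hφ') hx3 hx4 hy3 hy4 hok

/-! ### The explicit product arc set and its count -/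

/-- The explicit arc set: column `c`, phase `φ ∈ P c`, elements `⟨n₁, n₂⟩ = n₁ + n₂ ω` over the product of the two arcs. [folklore] -/
noncomputable def blockArcSet (p : ℕ) [NeZero p] (a b : ZMod p) (P : Fin 3 × Fin 3 → Finset (ℤ × ℤ))
    (lo₁ hi₁ lo₂ hi₂ : Fin 3 × Fin 3 → ℤ × ℤ → ℤ) : Finset ((Fin 3 × Fin 3) × QuadraticAlgebra (ZMod p) a b) :=
  (univ : Finset (Fin 3 × Fin 3)).biUnion fun c => (P c).biUnion fun φ =>
    (Icc (bStart p φ.1 (lo₁ c φ)) (bStop p φ.1 (hi₁ c φ)) ×ˢ Icc (bStart p φ.2 (lo₂ c φ)) (bStop p φ.2 (hi₂ c φ))).image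
      fun n : ℤ × ℤ => (c, (⟨(n.1 : ZMod p), (n.2 : ZMod p)⟩ : QuadraticAlgebra (ZMod p) a b))

section

variable [NeZero p] {P : Fin 3 × Fin 3 → Finset (ℤ × ℤ)} {lo₁ hi₁ lo₂ hi₂ : Fin 3 × Fin 3 → ℤ × ℤ → ℤ}
  (hP : ∀ c, ∀ φ ∈ P c, (0 ≤ φ.1 ∧ φ.1 < 8) ∧ (0 ≤ φ.2 ∧ φ.2 < 8))
  (hlo₁ : ∀ c, ∀ φ ∈ P c, 0 ≤ lo₁ c φ) (hhi₁ : ∀ c, ∀ φ ∈ P c, 0 ≤ hi₁ c φ)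
  (hlo₂ : ∀ c, ∀ φ ∈ P c, 0 ≤ lo₂ c φ) (hhi₂ : ∀ c, ∀ φ ∈ P c, 0 ≤ hi₂ c φ)
include hP hlo₁ hhi₁ hlo₂ hhi₂

/-- **The arc set lies in the block cell set.** [folklore] -/
theorem blockArcSet_subset : blockArcSet p a b P lo₁ hi₁ lo₂ hi₂ ⊆ blockCells p a b P lo₁ hi₁ lo₂ hi₂ := by
  intro x hx
  simp only [blockArcSet, mem_biUnion, mem_univ, true_and, mem_image, mem_product] at hx
  obtain ⟨c, φ, hφ, n, ⟨hn1, hn2⟩, rfl⟩ := hx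
  obtain ⟨h0, hp', h1, h2⟩ := b_bounds (hP c φ hφ).1 (hlo₁ c φ hφ) (hhi₁ c φ hφ) hn1
  obtain ⟨h0', hp'', h1', h2'⟩ := b_bounds (hP c φ hφ).2 (hlo₂ c φ hφ) (hhi₂ c φ hφ) hn2
  rw [mem_blockCells]
  refine ⟨φ, hφ, ?_, ?_⟩
  · simp only [PhaseArcs.val_cast_of_bounds h0 hp']
    exact ⟨h1, h2⟩
  · simp only [PhaseArcs.val_cast_of_bounds h0' hp'']
    exact ⟨h1', h2'⟩

omit [Fintype (QuadraticAlgebra (ZMod p) a b)] in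
/-- The element map `n ↦ (c, n₁ + n₂ x)` is injective on a product of arcs. [folklore] -/
theorem injOn_arcs (c : Fin 3 × Fin 3) {φ : ℤ × ℤ} (hφ : φ ∈ P c) :
    Set.InjOn (fun n : ℤ × ℤ => (c, (⟨(n.1 : ZMod p), (n.2 : ZMod p)⟩ : QuadraticAlgebra (ZMod p) a b)))
      ((Icc (bStart p φ.1 (lo₁ c φ)) (bStop p φ.1 (hi₁ c φ)) ×ˢ
        Icc (bStart p φ.2 (lo₂ c φ)) (bStop p φ.2 (hi₂ c φ)) : Finset (ℤ × ℤ)) : Set (ℤ × ℤ)) := by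
  intro n hn n' hn' e
  rw [mem_coe, mem_product] at hn hn'
  simp only [Prod.mk.injEq, true_and, QuadraticAlgebra.mk.injEq] at e
  have hb1 := b_bounds (hP c φ hφ).1 (hlo₁ c φ hφ) (hhi₁ c φ hφ) hn.1
  have hb2 := b_bounds (hP c φ hφ).2 (hlo₂ c φ hφ) (hhi₂ c φ hφ) hn.2
  have hb1' := b_bounds (hP c φ hφ).1 (hlo₁ c φ hφ) (hhi₁ c φ hφ) hn'.1
  have hb2' := b_bounds (hP c φ hφ).2 (hlo₂ c φ hφ) (hhi₂ c φ hφ) hn'.2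
  have e1 := congrArg (fun z : ZMod p => (z.val : ℤ)) e.1
  have e2 := congrArg (fun z : ZMod p => (z.val : ℤ)) e.2
  simp only [PhaseArcs.val_cast_of_bounds hb1.1 hb1.2.1, PhaseArcs.val_cast_of_bounds hb1'.1 hb1'.2.1,
    PhaseArcs.val_cast_of_bounds hb2.1 hb2.2.1, PhaseArcs.val_cast_of_bounds hb2'.1 hb2'.2.1] at e1 e2
  exact Prod.ext e1 e2

omit [Fintype (QuadraticAlgebra (ZMod p) a b)] in
/-- **Exact count of the arc set**: `Σ_c Σ_{φ ∈ P c} len₁ · len₂`. [folklore] -/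
theorem card_blockArcSet : #(blockArcSet p a b P lo₁ hi₁ lo₂ hi₂) =
    ∑ c, ∑ φ ∈ P c, (bLen p φ.1 (lo₁ c φ) (hi₁ c φ)).toNat * (bLen p φ.2 (lo₂ c φ) (hi₂ c φ)).toNat := by
  rw [blockArcSet, card_biUnion]
  · refine sum_congr rfl fun c _ => ?_
    rw [card_biUnion]
    · refine sum_congr rfl fun φ hφ => ?_
      rw [card_image_of_injOn (injOn_arcs hP hlo₁ hhi₁ hlo₂ hhi₂ c hφ), card_product, Int.card_Icc, Int.card_Icc]
      rfl
    · -- blocks of distinct phases in one column are disjoint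
      intro φ hφ φ' hφ' hne
      rw [Function.onFun, disjoint_left]
      intro x hx hx'
      rw [mem_image] at hx hx'
      obtain ⟨n, hn, rfl⟩ := hx
      obtain ⟨n', hn', e⟩ := hx'
      rw [mem_product] at hn hn'
      simp only [Prod.mk.injEq, true_and, QuadraticAlgebra.mk.injEq] at e
      have hb1 := b_bounds (hP c φ hφ).1 (hlo₁ c φ hφ) (hhi₁ c φ hφ) hn.1
      have hb2 := b_bounds (hP c φ hφ).2 (hlo₂ c φ hφ) (hhi₂ c φ hφ) hn.2
      have hb1' := b_bounds (hP c φ' hφ').1 (hlo₁ c φ' hφ') (hhi₁ c φ' hφ') hn'.1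
      have hb2' := b_bounds (hP c φ' hφ').2 (hlo₂ c φ' hφ') (hhi₂ c φ' hφ') hn'.2
      have e1 := congrArg (fun z : ZMod p => (z.val : ℤ)) e.1
      have e2 := congrArg (fun z : ZMod p => (z.val : ℤ)) e.2
      simp only [PhaseArcs.val_cast_of_bounds hb1.1 hb1.2.1, PhaseArcs.val_cast_of_bounds hb1'.1 hb1'.2.1,
        PhaseArcs.val_cast_of_bounds hb2.1 hb2.2.1, PhaseArcs.val_cast_of_bounds hb2'.1 hb2'.2.1] at e1 e2
      -- n' = n coordinatewise; the trims are ≥ 0, so both phases are determined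
      have hl1 := hlo₁ c φ hφ; have hh1 := hhi₁ c φ hφ; have hl1' := hlo₁ c φ' hφ'; have hh1' := hhi₁ c φ' hφ'
      have hl2 := hlo₂ c φ hφ; have hh2 := hhi₂ c φ hφ; have hl2' := hlo₂ c φ' hφ'; have hh2' := hhi₂ c φ' hφ'
      have hp0 : (0 : ℤ) < p := by have := NeZero.pos p; exact_mod_cast this
      apply hne
      refine Prod.ext ?_ ?_
      · by_contra hne1
        rcases lt_or_gt_of_ne hne1 with hlt | hlt
        · have : (φ.1 + 1) * (p : ℤ) ≤ φ'.1 * p := by nlinarith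
          omega
        · have : (φ'.1 + 1) * (p : ℤ) ≤ φ.1 * p := by nlinarith
          omega
      · by_contra hne2
        rcases lt_or_gt_of_ne hne2 with hlt | hlt
        · have : (φ.2 + 1) * (p : ℤ) ≤ φ'.2 * p := by nlinarith
          omega
        · have : (φ'.2 + 1) * (p : ℤ) ≤ φ.2 * p := by nlinarith
          omega
  · -- different columns give disjoint sets
    intro c _ c' _ hne
    rw [Function.onFun, disjoint_left]
    intro x hx hx'
    simp only [mem_biUnion, mem_image] at hx hx'
    obtain ⟨φ, -, n, -, rfl⟩ := hx
    obtain ⟨φ', -, n', -, e⟩ := hx'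
    simp only [Prod.mk.injEq] at e
    exact hne e.1.symm

end

end QuadArcs

end Summit.MatrixMultiplication.OmegaCensus
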